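import Summits.AtomisticToContinuum.Crystallization.Theorems.ChartedZeroExcessLayeredLatticeLiouvilleTW

/-!
# Zero-excess layered lattice Liouville — part TX (lens-2 g42/g43, towards K_F): the smooth partition-of-unity interpolant and its gradient

Given tilt–strain data `(Ψ, Q, σ)` on the window `W = win R` of a door set, the INTERPOLANT

  `u(y) := (Σ_{x ∈ W} φ₀(y − x))⁻¹ • Σ_{x ∈ W} φ₀(y − x) • (Ψ x + Q x (y − x))`

(`φ₀` the fixed bump of part TW: `= 1` on the unit ball, `= 0` off the `17/16`-ball) is smooth wherever the weight `D(y) = Σ φ₀(y − x)` is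
non-zero — in particular on the ball `‖y‖ < R − 9/10`, where `D ≥ 1` by the covering radius `< 9/10` (TW XXIII.1) — and its gradient is
pointwise close to the rotation field: for every base site `x₀ ∈ W` with `dist y x₀ ≤ 6/5`,

  `‖∇u(y) − Q x₀‖ ≤ C₁(δ, M) · Σ_{x ∈ W, dist x y ≤ 5/2} σ x`            (★, `norm_fderiv_interp_sub_rot_le`)

with `C₁ = 7·(1 + M + M·N₁)·(1 + N₁)`, `M` the bound on `‖∇φ₀‖` (TW XXIII.2), `N₁ = (17/(8δ) + 1)³` the local count (TW XXIII.3).  Ingredients: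
the algebraic split `Σ φ•A_x = D•A_{x₀} + Σ φ•(A_x − A_{x₀})` (any `x₀`), the product/inverse rules, TS frame compatibility
`‖Q x − Q x₀‖ ≤ 3(2σ x + σ x₀)` for `dist x x₀ ≤ 6/5 + 17/16 ≤ 4 − 3aHi/2` (`aHi ≤ 8/7`), and the data clause at `x₀`
(`‖Q x₀ (x − x₀) − (Ψ x − Ψ x₀)‖ ≤ σ x₀`).  Consequences: `‖∇u(y)‖ ≤ 1 + C₁·Σ_W σ` on that ball, hence `u` is Lipschitz there (convexity,
mean value inequality).  All constants explicit in `(δ, M)`; nothing depends on `R`, `S` or the data.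

No `sorry`, no new axioms, no type-class declarations, no custom syntax, no option pragmas.  ENERGY-FREE, θ-FREE, chart-free.
-/

noncomputable section

open scoped BigOperators RealInnerProductSpace NNReal
open MeasureTheory Set Metric Filter Topology
open Summit.AtomisticToContinuum.Crystallization.Theorems.ChartedPlanarOrderRigidityDoor (E3 atomsIn)
open Summit.AtomisticToContinuum.Crystallization.Theorems.ChartedPlanarOrderDensityDichotomy (μS IsSep nK nK_nonneg)
open Summit.AtomisticToContinuum.Crystallization.Theorems.ChartedPlanarOrderCleanScaleP (IsCleanP IsDoorSetP isCleanP_μS_iff)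
open Literature.Geometry.DiscreteGeometry (IsTwoShellGoodSet)

namespace Summit.AtomisticToContinuum.Crystallization.Theorems.ChartedZeroExcessLayeredLatticeLiouville

/-! ### XXIV.1 Definitions and algebra -/

section Defs

variable (W : Finset E3) (Ψ : E3 → E3) (Q : E3 → (E3 ≃ₗᵢ[ℝ] E3))

/-- the rotation at `x` as a continuous linear map. -/
def rotL (x : E3) : E3 →L[ℝ] E3 := ((Q x).toContinuousLinearEquiv : E3 →L[ℝ] E3)

/-- evaluation of `rotL`. [this file] -/
@[simp] theorem rotL_apply (x v : E3) : rotL Q x v = Q x v := rfl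

/-- the weight `D(y) = Σ_{x ∈ W} φ₀(y − x)`. -/
def Dsum (y : E3) : ℝ := ∑ x ∈ W, φ₀ (y - x)

/-- the local affine model at `x`: `A_x(y) = Ψ x + Q x (y − x)`. -/
def affA (x y : E3) : E3 := Ψ x + Q x (y - x)

/-- the numerator `Σ_{x ∈ W} φ₀(y − x) • A_x(y)`. -/
def Nsum (y : E3) : E3 := ∑ x ∈ W, φ₀ (y - x) • affA Ψ Q x y

/-- ★ the interpolant `u = D⁻¹ • N`. -/
def interp (y : E3) : E3 := (Dsum W y)⁻¹ • Nsum W Ψ Q y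

/-- the error numerator relative to the base `x₀`: `Σ_{x ∈ W} φ₀(y − x) • (A_x(y) − A_{x₀}(y))`. -/
def Esum (x₀ y : E3) : E3 := ∑ x ∈ W, φ₀ (y - x) • (affA Ψ Q x y - affA Ψ Q x₀ y)

variable {W Ψ Q}

/-- the cutoff sum `Dsum` is nonnegative. [this file] -/
theorem Dsum_nonneg (y : E3) : 0 ≤ Dsum W y := Finset.sum_nonneg fun _ _ => φ₀_nonneg _

/-- a covered point has weight `≥ 1`. -/
theorem one_le_Dsum {x y : E3} (hx : x ∈ W) (h : dist y x ≤ 1) : 1 ≤ Dsum W y := by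
  unfold Dsum
  rw [← φ₀_sub_eq_one_of_dist_le h]
  exact Finset.single_le_sum (fun x' _ => φ₀_nonneg (y - x')) hx

/-- `Dsum W y` is at most the number of window sites within `17/16` of `y`. [this file] -/
theorem Dsum_le_card_filter (y : E3) : Dsum W y ≤ ((W.filter fun x => dist x y ≤ 17 / 16).card : ℝ) := by
  unfold Dsum
  rw [← Finset.sum_filter_add_sum_filter_not W (fun x => dist x y ≤ 17 / 16)]
  have h0 : ∑ x ∈ W.filter (fun x => ¬ dist x y ≤ 17 / 16), φ₀ (y - x) = 0 := by
    refine Finset.sum_eq_zero fun x hx => ?_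
    have hx' := (Finset.mem_filter.1 hx).2
    exact φ₀_sub_eq_zero_of_le_dist (by rw [dist_comm]; exact (not_le.1 hx').le)
  rw [h0, add_zero]
  calc ∑ x ∈ W.filter (fun x => dist x y ≤ 17 / 16), φ₀ (y - x) ≤ ∑ x ∈ W.filter (fun x => dist x y ≤ 17 / 16), (1 : ℝ) :=
        Finset.sum_le_sum fun x _ => φ₀_le_one _
    _ = _ := by simp

/-- the algebraic split of the numerator about any base `x₀`. -/
theorem Nsum_eq (x₀ y : E3) : Nsum W Ψ Q y = Dsum W y • affA Ψ Q x₀ y + Esum W Ψ Q x₀ y := by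
  unfold Nsum Dsum Esum
  rw [Finset.sum_smul, ← Finset.sum_add_distrib]
  refine Finset.sum_congr rfl fun x _ => ?_
  rw [smul_sub]; abel

/-- hence, where the weight is non-zero, `u = A_{x₀} + D⁻¹ • E_{x₀}`. -/
theorem interp_eq (x₀ : E3) {y : E3} (hD : Dsum W y ≠ 0) :
    interp W Ψ Q y = affA Ψ Q x₀ y + (Dsum W y)⁻¹ • Esum W Ψ Q x₀ y := by
  unfold interp
  rw [Nsum_eq x₀, smul_add, smul_smul, inv_mul_cancel₀ hD, one_smul]

/-- the difference of two local affine models, rearranged on the bond `x₀ → x`. -/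
theorem affA_sub_affA (x x₀ y : E3) :
    affA Ψ Q x y - affA Ψ Q x₀ y = (Ψ x - Ψ x₀ - Q x₀ (x - x₀)) + (Q x (y - x) - Q x₀ (y - x)) := by
  unfold affA
  have h : Q x₀ (y - x₀) = Q x₀ (y - x) + Q x₀ (x - x₀) := by rw [← map_add]; congr 1; abel
  rw [h]; abel

end Defs

/-! ### XXIV.2 Derivatives -/

section Deriv

variable {W : Finset E3} {Ψ : E3 → E3} {Q : E3 → (E3 ≃ₗᵢ[ℝ] E3)}

/-- derivative of the cutoff sum `Dsum`. [this file] -/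
theorem hasFDerivAt_Dsum (y : E3) : HasFDerivAt (Dsum W) (∑ x ∈ W, fderiv ℝ φ₀ (y - x)) y := by
  have h := HasFDerivAt.fun_sum (u := W) (A := fun x y => φ₀ (y - x)) (A' := fun x => fderiv ℝ φ₀ (y - x)) (x := y)
    fun x _ => hasFDerivAt_φ₀_sub x y
  exact h

/-- derivative of the affine chart map `affA`. [this file] -/
theorem hasFDerivAt_affA (x y : E3) : HasFDerivAt (affA Ψ Q x) (rotL Q x) y := by
  have h1 : HasFDerivAt (fun y : E3 => Q x (y - x)) (rotL Q x) y := by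
    have h := (rotL Q x).hasFDerivAt.comp y (hasFDerivAt_sub_const x)
    rw [ContinuousLinearMap.comp_id] at h
    exact h
  exact h1.const_add (Ψ x)

/-- the derivative of one error summand. -/
theorem hasFDerivAt_Esummand (x x₀ y : E3) :
    HasFDerivAt (fun y => φ₀ (y - x) • (affA Ψ Q x y - affA Ψ Q x₀ y))
      (φ₀ (y - x) • (rotL Q x - rotL Q x₀) + (fderiv ℝ φ₀ (y - x)).smulRight (affA Ψ Q x y - affA Ψ Q x₀ y)) y :=
  (hasFDerivAt_φ₀_sub x y).smul ((hasFDerivAt_affA x y).sub (hasFDerivAt_affA x₀ y))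

/-- the derivative of the error numerator. -/
def EsumDeriv (W : Finset E3) (Ψ : E3 → E3) (Q : E3 → (E3 ≃ₗᵢ[ℝ] E3)) (x₀ y : E3) : E3 →L[ℝ] E3 :=
  ∑ x ∈ W, (φ₀ (y - x) • (rotL Q x - rotL Q x₀) + (fderiv ℝ φ₀ (y - x)).smulRight (affA Ψ Q x y - affA Ψ Q x₀ y))

/-- derivative of the weighted chart sum `Esum`. [this file] -/
theorem hasFDerivAt_Esum (x₀ y : E3) : HasFDerivAt (Esum W Ψ Q x₀) (EsumDeriv W Ψ Q x₀ y) y :=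
  HasFDerivAt.fun_sum fun x _ => hasFDerivAt_Esummand x x₀ y

/-- the derivative of the inverse weight. -/
theorem hasFDerivAt_inv_Dsum {y : E3} (hD : Dsum W y ≠ 0) :
    HasFDerivAt (fun z => (Dsum W z)⁻¹) ((-((Dsum W y) ^ 2)⁻¹) • ∑ x ∈ W, fderiv ℝ φ₀ (y - x)) y :=
  (hasDerivAt_inv hD).comp_hasFDerivAt y (hasFDerivAt_Dsum y)

/-- ★ the derivative of the interpolant at a point of non-zero weight, relative to any base `x₀`. -/
def interpDeriv (W : Finset E3) (Ψ : E3 → E3) (Q : E3 → (E3 ≃ₗᵢ[ℝ] E3)) (x₀ y : E3) : E3 →L[ℝ] E3 :=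
  rotL Q x₀ + ((Dsum W y)⁻¹ • EsumDeriv W Ψ Q x₀ y +
    (((-((Dsum W y) ^ 2)⁻¹) • ∑ x ∈ W, fderiv ℝ φ₀ (y - x)).smulRight (Esum W Ψ Q x₀ y)))

/-- the region where the cutoff sum is nonzero is open. [this file] -/
theorem isOpen_Dsum_ne_zero : IsOpen {y : E3 | Dsum W y ≠ 0} :=
  isOpen_ne_fun (continuous_finsetSum W fun x _ => (contDiff_φ₀_sub x (n := 0)).continuous) continuous_const

/-- derivative of the interpolant where the cutoff sum is nonzero. [this file] -/
theorem hasFDerivAt_interp (x₀ : E3) {y : E3} (hD : Dsum W y ≠ 0) :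
    HasFDerivAt (interp W Ψ Q) (interpDeriv W Ψ Q x₀ y) y := by
  have hev : interp W Ψ Q =ᶠ[𝓝 y] fun z => affA Ψ Q x₀ z + (Dsum W z)⁻¹ • Esum W Ψ Q x₀ z := by
    filter_upwards [isOpen_Dsum_ne_zero.mem_nhds hD] with z hz
    exact interp_eq x₀ hz
  refine HasFDerivAt.congr_of_eventuallyEq ?_ hev
  exact (hasFDerivAt_affA x₀ y).add ((hasFDerivAt_inv_Dsum hD).smul (hasFDerivAt_Esum x₀ y))

/-- the `fderiv` of the interpolant, explicitly. [this file] -/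
theorem fderiv_interp_eq (x₀ : E3) {y : E3} (hD : Dsum W y ≠ 0) : fderiv ℝ (interp W Ψ Q) y = interpDeriv W Ψ Q x₀ y :=
  (hasFDerivAt_interp x₀ hD).fderiv

/-- the interpolant is differentiable where the cutoff sum is nonzero. [this file] -/
theorem differentiableAt_interp {y : E3} (hD : Dsum W y ≠ 0) : DifferentiableAt ℝ (interp W Ψ Q) y :=
  (hasFDerivAt_interp y hD).differentiableAt

end Deriv

/-! ### XXIV.3 Pointwise gradient bounds -/

section Bounds

/-- the local-count constant `N₁(δ) = (2·(17/16)/δ + 1)³` (TW XXIII.3 at radius `17/16`). -/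
def Nloc (δ : ℝ) : ℝ := (2 * (17 / 16) / δ + 1) ^ 3

/-- the local multiplicity bound `Nloc δ` is at least one. [this file] -/
theorem one_le_Nloc {δ : ℝ} (hδ : 0 < δ) : 1 ≤ Nloc δ := by
  unfold Nloc
  have h : (1 : ℝ) ≤ 2 * (17 / 16) / δ + 1 := by
    have : 0 ≤ 2 * (17 / 16) / δ := by positivity
    linarith
  exact one_le_pow₀ h

/-- ★ the gradient constant `C₁(δ, M) = 7·(1 + M + M·N₁)·(1 + N₁)`. -/
def Cgrad (δ M : ℝ) : ℝ := 7 * (1 + M + M * Nloc δ) * (1 + Nloc δ)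

/-- the gradient constant `Cgrad δ M` is nonnegative. [this file] -/
theorem Cgrad_nonneg {δ M : ℝ} (hδ : 0 < δ) (hM : 0 ≤ M) : 0 ≤ Cgrad δ M := by
  unfold Cgrad
  have h1 := one_le_Nloc hδ
  have : 0 ≤ M * Nloc δ := by positivity
  positivity

/-- a sum whose terms vanish off `p` and are dominated on `p`. -/
theorem sum_le_sum_filter_of_vanish {W : Finset E3} {p : E3 → Prop} [DecidablePred p] {g b : E3 → ℝ}
    (h0 : ∀ x ∈ W, ¬ p x → g x = 0) (hle : ∀ x ∈ W, p x → g x ≤ b x) : ∑ x ∈ W, g x ≤ ∑ x ∈ W.filter p, b x := by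
  rw [← Finset.sum_filter_add_sum_filter_not W p g]
  have hz : ∑ x ∈ W.filter (fun x => ¬ p x), g x = 0 :=
    Finset.sum_eq_zero fun x hx => h0 x (Finset.mem_filter.1 hx).1 (Finset.mem_filter.1 hx).2
  rw [hz, add_zero]
  exact Finset.sum_le_sum fun x hx => hle x (Finset.mem_filter.1 hx).1 (Finset.mem_filter.1 hx).2

variable {aHi δ : ℝ} {S : Set E3} {R : ℝ} {Ψ : E3 → E3} {Q : E3 → (E3 ≃ₗᵢ[ℝ] E3)} {σ : E3 → ℝ}

/-- **per-site bounds** on the bond `x₀ → x` (`dist x y ≤ 17/16`, `dist y x₀ ≤ 6/5`, so `dist x x₀ ≤ 181/80 ≤ 4 − 3aHi/2` for `aHi ≤ 8/7`):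
frame compatibility (TS) and the data clause at `x₀`. -/
theorem norm_rotL_sub_le_and (hS : IsDoorSetP aHi δ S) (haHi : aHi ≤ 8 / 7) (hd : IsTiltStrainData S R Ψ Q σ) {x x₀ y : E3}
    (hx : x ∈ atomsIn (μS S) 0 R) (hx₀ : x₀ ∈ atomsIn (μS S) 0 R) (hxy : dist x y ≤ 17 / 16) (hyx₀ : dist y x₀ ≤ 6 / 5) :
    ‖rotL Q x - rotL Q x₀‖ ≤ 3 * (2 * σ x + σ x₀) ∧
      ‖affA Ψ Q x y - affA Ψ Q x₀ y‖ ≤ σ x₀ + 3 * (2 * σ x + σ x₀) * (17 / 16) := by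
  have hxx₀ : dist x x₀ ≤ 4 - 3 / 2 * aHi := by
    have h := dist_triangle x y x₀
    linarith
  have hgood : IsTwoShellGoodSet (1 / 16) (9 / 10) aHi S x₀ := (isCleanP_μS_iff S).1 hS.2.2.1 x₀ (mem_atomsIn_iff.1 hx₀).1
  have hQ : ‖rotL Q x - rotL Q x₀‖ ≤ 3 * (2 * σ x + σ x₀) := opNorm_rot_sub_le_of_good hd hx hx₀ hgood hxx₀
  refine ⟨hQ, ?_⟩
  have hxS : x ∈ S := (mem_atomsIn_iff.1 hx).1
  have hdat : ‖Ψ x - Ψ x₀ - Q x₀ (x - x₀)‖ ≤ σ x₀ := by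
    have h := hd.2.2 x₀ hx₀ x hxS (by linarith [dist_triangle x y x₀] : dist x x₀ ≤ 4)
    rw [dist_eq_norm, norm_sub_rev] at h
    simpa [sub_sub] using h
  have hlin : ‖Q x (y - x) - Q x₀ (y - x)‖ ≤ 3 * (2 * σ x + σ x₀) * (17 / 16) := by
    have h1 : Q x (y - x) - Q x₀ (y - x) = (rotL Q x - rotL Q x₀) (y - x) := by simp
    rw [h1]
    have hs0 : 0 ≤ 3 * (2 * σ x + σ x₀) := le_trans (norm_nonneg _) hQ
    calc ‖(rotL Q x - rotL Q x₀) (y - x)‖ ≤ ‖rotL Q x - rotL Q x₀‖ * ‖y - x‖ := ContinuousLinearMap.le_opNorm _ _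
      _ ≤ 3 * (2 * σ x + σ x₀) * (17 / 16) := by
          have hyx : ‖y - x‖ ≤ 17 / 16 := by rw [← dist_eq_norm, dist_comm]; exact hxy
          exact mul_le_mul hQ hyx (norm_nonneg _) hs0
  rw [affA_sub_affA]
  exact (norm_add_le _ _).trans (add_le_add hdat hlin)

/-- the norm of the weight derivative: `‖D'(y)‖ ≤ M · N₁`. -/
theorem norm_DsumDeriv_le (hδ : 0 < δ) (hsep : IsSep δ S) {M : ℝ} (hM0 : 0 ≤ M) (hM : ∀ z, ‖fderiv ℝ φ₀ z‖ ≤ M)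
    (W : Finset E3) (hW : ↑W ⊆ S) (y : E3) : ‖∑ x ∈ W, fderiv ℝ φ₀ (y - x)‖ ≤ M * Nloc δ := by
  have h1 : ‖∑ x ∈ W, fderiv ℝ φ₀ (y - x)‖ ≤ ∑ x ∈ W, ‖fderiv ℝ φ₀ (y - x)‖ := norm_sum_le _ _
  have h2 : ∑ x ∈ W, ‖fderiv ℝ φ₀ (y - x)‖ ≤ ∑ x ∈ W.filter (fun x => dist x y ≤ 17 / 16), M := by
    refine sum_le_sum_filter_of_vanish (fun x _ hx => ?_) (fun x _ _ => hM _)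
    rw [fderiv_φ₀_eq_zero_of_lt_norm (by rw [← dist_eq_norm, dist_comm]; exact not_le.1 hx), norm_zero]
  have h3 : ∑ x ∈ W.filter (fun x => dist x y ≤ 17 / 16), M = ((W.filter fun x => dist x y ≤ 17 / 16).card : ℝ) * M := by
    simp [Finset.sum_const, nsmul_eq_mul]
  have h4 := card_filter_dist_le_le hδ hsep W hW y (by norm_num : (0 : ℝ) ≤ 17 / 16)
  calc ‖∑ x ∈ W, fderiv ℝ φ₀ (y - x)‖ ≤ ((W.filter fun x => dist x y ≤ 17 / 16).card : ℝ) * M := by linarith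
    _ ≤ Nloc δ * M := mul_le_mul_of_nonneg_right h4 hM0
    _ = M * Nloc δ := mul_comm _ _

/-- the norm of the error numerator: `‖E_{x₀}(y)‖ ≤ Σ_{dist x y ≤ 17/16} ‖A_x(y) − A_{x₀}(y)‖`. -/
theorem norm_Esum_le (W : Finset E3) (x₀ y : E3) :
    ‖Esum W Ψ Q x₀ y‖ ≤ ∑ x ∈ W.filter (fun x => dist x y ≤ 17 / 16), ‖affA Ψ Q x y - affA Ψ Q x₀ y‖ := by
  unfold Esum
  refine (norm_sum_le _ _).trans (sum_le_sum_filter_of_vanish (fun x _ hx => ?_) (fun x _ _ => ?_))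
  · rw [φ₀_sub_eq_zero_of_le_dist (by rw [dist_comm]; exact (not_le.1 hx).le), zero_smul, norm_zero]
  · rw [norm_smul, Real.norm_eq_abs, abs_of_nonneg (φ₀_nonneg _)]
    exact (mul_le_mul_of_nonneg_right (φ₀_le_one _) (norm_nonneg _)).trans (by rw [one_mul])

/-- the norm of the derivative of the error numerator. -/
theorem norm_EsumDeriv_le {M : ℝ} (hM : ∀ z, ‖fderiv ℝ φ₀ z‖ ≤ M) (W : Finset E3) (x₀ y : E3) :
    ‖EsumDeriv W Ψ Q x₀ y‖ ≤ ∑ x ∈ W.filter (fun x => dist x y ≤ 17 / 16), (‖rotL Q x - rotL Q x₀‖ + M * ‖affA Ψ Q x y - affA Ψ Q x₀ y‖) := by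
  unfold EsumDeriv
  refine (norm_sum_le _ _).trans (sum_le_sum_filter_of_vanish (fun x _ hx => ?_) (fun x _ _ => ?_))
  · have hxy : 17 / 16 < dist y x := by rw [dist_comm]; exact not_le.1 hx
    have h1 : φ₀ (y - x) = 0 := φ₀_sub_eq_zero_of_le_dist hxy.le
    have h2 : fderiv ℝ φ₀ (y - x) = 0 := fderiv_φ₀_eq_zero_of_lt_norm (by rwa [← dist_eq_norm])
    refine le_antisymm ?_ (norm_nonneg _)
    calc ‖φ₀ (y - x) • (rotL Q x - rotL Q x₀) + (fderiv ℝ φ₀ (y - x)).smulRight (affA Ψ Q x y - affA Ψ Q x₀ y)‖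
        ≤ ‖φ₀ (y - x) • (rotL Q x - rotL Q x₀)‖ + ‖(fderiv ℝ φ₀ (y - x)).smulRight (affA Ψ Q x y - affA Ψ Q x₀ y)‖ := norm_add_le _ _
      _ = 0 := by
          rw [norm_smul, ContinuousLinearMap.norm_smulRight_apply, h1, h2, norm_zero, norm_zero, zero_mul, zero_mul, add_zero]
  · refine (norm_add_le _ _).trans (add_le_add ?_ ?_)
    · rw [norm_smul, Real.norm_eq_abs, abs_of_nonneg (φ₀_nonneg _)]
      exact (mul_le_mul_of_nonneg_right (φ₀_le_one _) (norm_nonneg _)).trans (by rw [one_mul])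
    · rw [ContinuousLinearMap.norm_smulRight_apply]
      exact mul_le_mul_of_nonneg_right (hM _) (norm_nonneg _)

/-- the quotient-rule estimate: for weight `≥ 1`, `‖∇u − Q x₀‖ ≤ ‖E'‖ + ‖D'‖·‖E‖`. -/
theorem norm_interpDeriv_sub_rotL_le_aux {W : Finset E3} {x₀ y : E3} (hD : 1 ≤ Dsum W y) :
    ‖interpDeriv W Ψ Q x₀ y - rotL Q x₀‖ ≤
      ‖EsumDeriv W Ψ Q x₀ y‖ + ‖∑ x ∈ W, fderiv ℝ φ₀ (y - x)‖ * ‖Esum W Ψ Q x₀ y‖ := by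
  have hD0 : 0 < Dsum W y := lt_of_lt_of_le one_pos hD
  have hDinv : (Dsum W y)⁻¹ ≤ 1 := inv_le_one_of_one_le₀ hD
  have hDinv0 : 0 ≤ (Dsum W y)⁻¹ := inv_nonneg.2 hD0.le
  have hD2inv : ((Dsum W y) ^ 2)⁻¹ ≤ 1 := inv_le_one_of_one_le₀ (one_le_pow₀ hD)
  have hD2inv0 : 0 ≤ ((Dsum W y) ^ 2)⁻¹ := by positivity
  unfold interpDeriv
  rw [add_sub_cancel_left]
  refine (norm_add_le _ _).trans (add_le_add ?_ ?_)
  · rw [norm_smul, Real.norm_eq_abs, abs_of_nonneg hDinv0]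
    exact (mul_le_mul_of_nonneg_right hDinv (norm_nonneg _)).trans (by rw [one_mul])
  · rw [ContinuousLinearMap.norm_smulRight_apply, norm_smul, norm_neg, Real.norm_eq_abs, abs_of_nonneg hD2inv0]
    have h := mul_le_mul_of_nonneg_right hD2inv (norm_nonneg (∑ x ∈ W, fderiv ℝ φ₀ (y - x)))
    rw [one_mul] at h
    exact mul_le_mul_of_nonneg_right h (norm_nonneg _)

/-- ★★ **pointwise gradient bound** (★ of the header): on a door set with `aHi ≤ 8/7`, at a point of weight `≥ 1` within `6/5` of a base window
site `x₀`, `‖∇u(y) − Q x₀‖ ≤ C₁(δ, M) · Σ_{x ∈ W, dist x y ≤ 5/2} σ x`. -/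
theorem norm_interpDeriv_sub_rotL_le (hδ : 0 < δ) (hS : IsDoorSetP aHi δ S) (haHi : aHi ≤ 8 / 7) (hd : IsTiltStrainData S R Ψ Q σ)
    {M : ℝ} (hM0 : 0 ≤ M) (hM : ∀ z, ‖fderiv ℝ φ₀ z‖ ≤ M) (W : Finset E3) (hW : ∀ x, x ∈ W ↔ x ∈ atomsIn (μS S) 0 R)
    {x₀ y : E3} (hx₀ : x₀ ∈ W) (hyx₀ : dist y x₀ ≤ 6 / 5) (hD : 1 ≤ Dsum W y) :
    ‖interpDeriv W Ψ Q x₀ y - rotL Q x₀‖ ≤ Cgrad δ M * ∑ x ∈ W.filter (fun x => dist x y ≤ 5 / 2), σ x := by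
  have hsep : IsSep δ S := hS.2.1
  have hWS : (↑W : Set E3) ⊆ S := fun x hx => (mem_atomsIn_iff.1 ((hW x).1 hx)).1
  have hσ0 : ∀ x, 0 ≤ σ x := hd.2.1
  have hx₀A : x₀ ∈ atomsIn (μS S) 0 R := (hW x₀).1 hx₀
  set F := W.filter (fun x => dist x y ≤ 17 / 16) with hF
  set F' := W.filter (fun x => dist x y ≤ 5 / 2) with hF'
  set N := Nloc δ with hN
  have hN1 : 1 ≤ N := one_le_Nloc hδ
  have hMN0 : 0 ≤ M + M * N := by nlinarith
  -- the three norms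
  have hD' := norm_DsumDeriv_le hδ hsep hM0 hM W hWS y
  have hE := norm_Esum_le (Ψ := Ψ) (Q := Q) W x₀ y
  have hE' := norm_EsumDeriv_le (Ψ := Ψ) (Q := Q) hM W x₀ y
  have haux := norm_interpDeriv_sub_rotL_le_aux (Ψ := Ψ) (Q := Q) (x₀ := x₀) hD
  -- per-site domination on F
  have hterm : ∀ x ∈ F, ‖rotL Q x - rotL Q x₀‖ + (M + M * N) * ‖affA Ψ Q x y - affA Ψ Q x₀ y‖ ≤
      7 * (1 + M + M * N) * (σ x + σ x₀) := by
    intro x hx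
    have hxW : x ∈ W := (Finset.mem_filter.1 hx).1
    have hxy : dist x y ≤ 17 / 16 := (Finset.mem_filter.1 hx).2
    obtain ⟨h1, h2⟩ := norm_rotL_sub_le_and hS haHi hd ((hW x).1 hxW) hx₀A hxy hyx₀
    have hx0 := hσ0 x
    have hx00 := hσ0 x₀
    have h3 : (M + M * N) * ‖affA Ψ Q x y - affA Ψ Q x₀ y‖ ≤ (M + M * N) * (σ x₀ + 3 * (2 * σ x + σ x₀) * (17 / 16)) :=
      mul_le_mul_of_nonneg_left h2 hMN0
    nlinarith
  -- sum of the dominations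
  have hsumF : ∑ x ∈ F, (‖rotL Q x - rotL Q x₀‖ + (M + M * N) * ‖affA Ψ Q x y - affA Ψ Q x₀ y‖) ≤
      7 * (1 + M + M * N) * (∑ x ∈ F, σ x + (F.card : ℝ) * σ x₀) := by
    calc ∑ x ∈ F, (‖rotL Q x - rotL Q x₀‖ + (M + M * N) * ‖affA Ψ Q x y - affA Ψ Q x₀ y‖)
        ≤ ∑ x ∈ F, 7 * (1 + M + M * N) * (σ x + σ x₀) := Finset.sum_le_sum hterm
      _ = 7 * (1 + M + M * N) * (∑ x ∈ F, σ x + (F.card : ℝ) * σ x₀) := by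
          rw [← Finset.mul_sum, Finset.sum_add_distrib, Finset.sum_const, nsmul_eq_mul]
  -- comparison of the local sums
  have hFF' : ∑ x ∈ F, σ x ≤ ∑ x ∈ F', σ x := by
    refine Finset.sum_le_sum_of_subset_of_nonneg (fun x hx => ?_) fun x _ _ => hσ0 x
    have hx' := Finset.mem_filter.1 hx
    exact Finset.mem_filter.2 ⟨hx'.1, hx'.2.trans (by norm_num)⟩
  have hx₀F' : σ x₀ ≤ ∑ x ∈ F', σ x := by
    have hmem : x₀ ∈ F' := Finset.mem_filter.2 ⟨hx₀, by rw [dist_comm]; linarith⟩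
    exact Finset.single_le_sum (fun x _ => hσ0 x) hmem
  have hcardF : (F.card : ℝ) ≤ N := card_filter_dist_le_le hδ hsep W hWS y (by norm_num : (0 : ℝ) ≤ 17 / 16)
  have hS'0 : 0 ≤ ∑ x ∈ F', σ x := Finset.sum_nonneg fun x _ => hσ0 x
  -- assemble
  have hstep : ‖interpDeriv W Ψ Q x₀ y - rotL Q x₀‖ ≤
      ∑ x ∈ F, (‖rotL Q x - rotL Q x₀‖ + (M + M * N) * ‖affA Ψ Q x y - affA Ψ Q x₀ y‖) := by
    have hEsum0 : 0 ≤ ∑ x ∈ F, ‖affA Ψ Q x y - affA Ψ Q x₀ y‖ := Finset.sum_nonneg fun x _ => norm_nonneg _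
    have hprod : ‖∑ x ∈ W, fderiv ℝ φ₀ (y - x)‖ * ‖Esum W Ψ Q x₀ y‖ ≤ (M * N) * ∑ x ∈ F, ‖affA Ψ Q x y - affA Ψ Q x₀ y‖ :=
      mul_le_mul hD' hE (norm_nonneg _) (by positivity)
    calc ‖interpDeriv W Ψ Q x₀ y - rotL Q x₀‖
        ≤ ‖EsumDeriv W Ψ Q x₀ y‖ + ‖∑ x ∈ W, fderiv ℝ φ₀ (y - x)‖ * ‖Esum W Ψ Q x₀ y‖ := haux
      _ ≤ ∑ x ∈ F, (‖rotL Q x - rotL Q x₀‖ + M * ‖affA Ψ Q x y - affA Ψ Q x₀ y‖) +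
            (M * N) * ∑ x ∈ F, ‖affA Ψ Q x y - affA Ψ Q x₀ y‖ := add_le_add hE' hprod
      _ = ∑ x ∈ F, (‖rotL Q x - rotL Q x₀‖ + (M + M * N) * ‖affA Ψ Q x y - affA Ψ Q x₀ y‖) := by
          rw [Finset.mul_sum, ← Finset.sum_add_distrib]
          refine Finset.sum_congr rfl fun x _ => ?_
          ring
  have hfin : 7 * (1 + M + M * N) * (∑ x ∈ F, σ x + (F.card : ℝ) * σ x₀) ≤ Cgrad δ M * ∑ x ∈ F', σ x := by
    have h7 : 0 ≤ 7 * (1 + M + M * N) := by positivity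
    have hin : ∑ x ∈ F, σ x + (F.card : ℝ) * σ x₀ ≤ (1 + N) * ∑ x ∈ F', σ x := by
      have h1 : (F.card : ℝ) * σ x₀ ≤ N * ∑ x ∈ F', σ x := mul_le_mul hcardF hx₀F' (hσ0 x₀) (le_trans zero_le_one hN1)
      nlinarith
    calc 7 * (1 + M + M * N) * (∑ x ∈ F, σ x + (F.card : ℝ) * σ x₀) ≤ 7 * (1 + M + M * N) * ((1 + N) * ∑ x ∈ F', σ x) :=
          mul_le_mul_of_nonneg_left hin h7
      _ = Cgrad δ M * ∑ x ∈ F', σ x := by rw [hN]; unfold Cgrad; ring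
  exact hstep.trans (hsumF.trans hfin)

/-- the interpolant's derivative has norm `≤ 1 + C₁ · Σ_W σ` at such points (`‖Q x₀‖ ≤ 1`). -/
theorem norm_interpDeriv_le (hδ : 0 < δ) (hS : IsDoorSetP aHi δ S) (haHi : aHi ≤ 8 / 7) (hd : IsTiltStrainData S R Ψ Q σ)
    {M : ℝ} (hM0 : 0 ≤ M) (hM : ∀ z, ‖fderiv ℝ φ₀ z‖ ≤ M) (W : Finset E3) (hW : ∀ x, x ∈ W ↔ x ∈ atomsIn (μS S) 0 R)
    {x₀ y : E3} (hx₀ : x₀ ∈ W) (hyx₀ : dist y x₀ ≤ 6 / 5) (hD : 1 ≤ Dsum W y) :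
    ‖interpDeriv W Ψ Q x₀ y‖ ≤ 1 + Cgrad δ M * ∑ x ∈ W, σ x := by
  have h := norm_interpDeriv_sub_rotL_le hδ hS haHi hd hM0 hM W hW hx₀ hyx₀ hD
  have hQ : ‖rotL Q x₀‖ ≤ 1 := by
    unfold rotL
    exact (Q x₀).toLinearIsometry.norm_toContinuousLinearMap_le
  have hσ0 : ∀ x, 0 ≤ σ x := hd.2.1
  have hsub : ∑ x ∈ W.filter (fun x => dist x y ≤ 5 / 2), σ x ≤ ∑ x ∈ W, σ x :=
    Finset.sum_le_sum_of_subset_of_nonneg (Finset.filter_subset _ _) fun x _ _ => hσ0 x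
  have hC := Cgrad_nonneg hδ hM0
  calc ‖interpDeriv W Ψ Q x₀ y‖ ≤ ‖interpDeriv W Ψ Q x₀ y - rotL Q x₀‖ + ‖rotL Q x₀‖ := norm_le_norm_sub_add _ _
    _ ≤ Cgrad δ M * ∑ x ∈ W, σ x + 1 := add_le_add (h.trans (mul_le_mul_of_nonneg_left hsub hC)) hQ
    _ = 1 + Cgrad δ M * ∑ x ∈ W, σ x := add_comm _ _

end Bounds

end Summit.AtomisticToContinuum.Crystallization.Theorems.ChartedZeroExcessLayeredLatticeLiouville

end
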